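import Summits.CriticalPhenomena.PercolationContinuityZ3.Theorems.Transplant.Bcc111ClawSound
import HarnessLib

/-!
# The bcc (111)-films `F_m(bcc)`, exit-form routing certificate IX: the SYMMETRY `(a, b) ↦ (a + b, −b)` of the planar model — the classes clipped along
# `{p₀ ≤ t}` are mirror images of the kernel classes clipped along `{p₀ + p₁ ≤ s}`

builds on p205010 (kernel theorem, internal audit signed; external expert review pending) — NOT used in this file.
Lane `prim-bschramm`, seat `prim-bschramm-p2` (gen 48; class C1b, METHOD = input substitution; memo `HOME/bschramm/P2-LATTICES.md` §159); helper file
(`--supports stmt-CriticalPhenomena-4575 --as helper`).  The lattice map `M(a, b) = (a + b, −b)` is an involutive isometry of `𝕋` (it preserves the tree's `triNorm`)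
which PERMUTES THE UP-STEPS `U = {(1,0), (−1,1), (0,−1)}` (so it is induced by the level-preserving film automorphism `(x₀, x₁, x₂) ↦ (x₀, x₂, x₁)`) and
EXCHANGES the two clip families: `{p₀ ≤ t} ↔ {p₀ + p₁ ≤ t}`.  Hence every ingredient of the model «Bcc111ClawModel» is `M`-equivariant with the class parameters
swapped `(t_R, t_D, s_R, s_D) ↦ (s_R, s_D, t_R, t_D)`:
* §1 `Mp` and the equivariance of `tnZ`, `inBlk`, `isPocket`, `inRB`, `inDB`, `rem0`, `remM`, `certE`, `certW`, `tyOK`, **`admissible_Mp`**; `hexPts` (`mem_hexPts_iff`);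
* §2 the equivariance of legs (`LegProps.mapMp`), of the entry tests, of the hub slots (`hubCols_Mp`: direction index `1 ↔ 2`, chain ports exchanged for `i = 0`),
  and **`ClawProps.ofMp`**: a claw for the mirrored configuration of the mirrored class gives a claw for the original;
* §3 **`exists_claw`**: for EVERY block class `(t_R, t_D, s_R, s_D) ∈ [0,3]⁴` (`t_R ≤ t_D`, `s_R ≤ s_D`, `t_R = 3 ∨ s_R = 3`) and every admissible configuration a claw
  exists, from the kernel statements `ClawHOK` of the ten classes `t_R = t_D = 3` (taken as hypotheses here; discharged by «Bcc111ClawTableOK*»).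
[cite: DuminilCopinSidoraviciusTassion2016, §2.3 (proof of Fact 2)] [cite: ConwaySloane1999, Ch. 4 §7.1]
-/

namespace Summit.CriticalPhenomena.PercolationContinuityZ3.Theorems.Transplant

namespace Bcc111Claw

open BccClawX (Pt)

/-! ## §1 The mirror `M` and the equivariance of the model -/

/-- **The mirror** `M(a, b) = (a + b, −b)`. [folklore] -/
def Mp (p : Pt) : Pt := (p.1 + p.2, -p.2)

/-- `M` is an involution. [folklore] -/
@[simp] theorem Mp_Mp (p : Pt) : Mp (Mp p) = p := by obtain ⟨a, b⟩ := p; simp [Mp]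

/-- `M` is injective. [folklore] -/
theorem Mp_injective : Function.Injective Mp := fun p q h => by rw [← Mp_Mp p, h, Mp_Mp]

/-- `M` on lists is an involution. [folklore] -/
@[simp] theorem map_Mp_map_Mp (l : List Pt) : (l.map Mp).map Mp = l := by
  rw [List.map_map]; conv_rhs => rw [← List.map_id l]
  congr 1; funext p; simp

/-- `M` fixes the origin. [folklore] -/
@[simp] theorem Mp_zero : Mp (0, 0) = (0, 0) := rfl

/-- `M` compared through `==`. [folklore] -/
theorem Mp_beq (p q : Pt) : (Mp p == Mp q) = (p == q) := by
  by_cases h : p = q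
  · simp [h]
  · have : Mp p ≠ Mp q := fun e => h (Mp_injective e); simp [h, this]

/-- `M` compared with the origin through `==`. [folklore] -/
@[simp] theorem Mp_beq_zero (p : Pt) : (Mp p == (0, 0)) = (p == (0, 0)) := by
  have := Mp_beq p (0, 0); rwa [Mp_zero] at this

/-- `M` is additive on shifted columns: `M p + d = M (p + M d)`. [folklore] -/
theorem Mp_shift (p d : Pt) : ((Mp p).1 + d.1, (Mp p).2 + d.2) = Mp (p.1 + (Mp d).1, p.2 + (Mp d).2) := by
  obtain ⟨a, b⟩ := p; obtain ⟨x, y⟩ := d; simp only [Mp, Prod.mk.injEq]; constructor <;> ring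

/-- `M` on differences. [folklore] -/
theorem Mp_shift_sub (p d : Pt) : ((Mp p).1 - d.1, (Mp p).2 - d.2) = Mp (p.1 - (Mp d).1, p.2 - (Mp d).2) := by
  obtain ⟨a, b⟩ := p; obtain ⟨x, y⟩ := d; simp only [Mp, Prod.mk.injEq]; constructor <;> ring

/-- `M` preserves the hexagonal norm. [folklore] -/
theorem tnZ_Mp (p : Pt) : tnZ (Mp p) = tnZ p := by
  obtain ⟨a, b⟩ := p
  simp only [tnZ, Mp, abs_neg, show a + b + -b = a by ring]
  simp only [max_comm, max_left_comm]

/-- `M` exchanges the clip families of the blocks. [folklore] -/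
theorem inBlk_Mp (t s : ℕ) (p : Pt) : inBlk t s (Mp p) = inBlk s t p := by
  obtain ⟨a, b⟩ := p
  rw [Bool.eq_iff_iff]
  simp only [inBlk, tnZ_Mp, Bool.and_eq_true, decide_eq_true_eq]
  simp only [Mp, show a + b + -b = a by ring]
  tauto

/-- `nbrCount` over a list, head first. [folklore] -/
theorem nbrCount_cons (R : Pt → Bool) (p d : Pt) (ds : List Pt) :
    nbrCount R p (d :: ds) = (if R (p.1 + d.1, p.2 + d.2) = true then 1 else 0) + nbrCount R p ds := by
  unfold nbrCount; rw [List.filter_cons]; split_ifs <;> simp [Nat.add_comm]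

/-- `nbrCount` over the empty list. [folklore] -/
theorem nbrCount_nil (R : Pt → Bool) (p : Pt) : nbrCount R p [] = 0 := rfl

/-- Neighbour counts transform under `M` by mirroring the direction list. [folklore] -/
theorem nbrCount_Mp (R : Pt → Bool) (p : Pt) : ∀ ds : List Pt, nbrCount R (Mp p) ds = nbrCount (fun q => R (Mp q)) p (ds.map Mp)
  | [] => rfl
  | d :: ds => by simp only [List.map_cons, nbrCount_cons, Mp_shift, nbrCount_Mp R p ds]

/-- Neighbour counts do not depend on the order of the direction list. [folklore] -/
theorem nbrCount_perm (R : Pt → Bool) (p : Pt) {ds ds' : List Pt} (h : ds.Perm ds') : nbrCount R p ds = nbrCount R p ds' := by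
  unfold nbrCount; exact (h.filter _).length_eq

/-- Neighbour counts over the six directions are `M`-equivariant (`M` permutes the directions). [folklore] -/
theorem nbrCount_dirs_Mp (R R' : Pt → Bool) (h : ∀ q, R (Mp q) = R' q) (p : Pt) : nbrCount R (Mp p) dirs = nbrCount R' p dirs := by
  have hperm : (dirs.map Mp).Perm dirs := by decide
  rw [nbrCount_Mp, nbrCount_perm _ _ hperm]
  simp only [h]

/-- Neighbour counts over the up-steps are `M`-equivariant (`M` permutes `U`). [folklore] -/
theorem nbrCount_U_Mp (R R' : Pt → Bool) (h : ∀ q, R (Mp q) = R' q) (p : Pt) :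
    nbrCount R (Mp p) [(1, 0), (-1, 1), (0, -1)] = nbrCount R' p [(1, 0), (-1, 1), (0, -1)] := by
  have hperm : (([(1, 0), (-1, 1), (0, -1)] : List Pt).map Mp).Perm [(1, 0), (-1, 1), (0, -1)] := by decide
  rw [nbrCount_Mp, nbrCount_perm _ _ hperm]
  simp only [h]

/-- Neighbour counts over the down-steps are `M`-equivariant. [folklore] -/
theorem nbrCount_NU_Mp (R R' : Pt → Bool) (h : ∀ q, R (Mp q) = R' q) (p : Pt) :
    nbrCount R (Mp p) [(-1, 0), (1, -1), (0, 1)] = nbrCount R' p [(-1, 0), (1, -1), (0, 1)] := by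
  have hperm : (([(-1, 0), (1, -1), (0, 1)] : List Pt).map Mp).Perm [(-1, 0), (1, -1), (0, 1)] := by decide
  rw [nbrCount_Mp, nbrCount_perm _ _ hperm]
  simp only [h]

/-- Pockets are `M`-equivariant. [folklore] -/
theorem isPocket_Mp (t s : ℕ) (p : Pt) : isPocket t s (Mp p) = isPocket s t p := by
  simp only [isPocket, inBlk_Mp, tnZ_Mp, nbrCount_dirs_Mp (inBlk t s) (inBlk s t) (inBlk_Mp t s)]

/-- Rerouting columns are `M`-equivariant. [folklore] -/
theorem inRB_Mp (t s : ℕ) (p : Pt) : inRB t s (Mp p) = inRB s t p := by simp only [inRB, inBlk_Mp, isPocket_Mp]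

/-- Cleared columns are `M`-equivariant. [folklore] -/
theorem inDB_Mp (tR tD sR sD : ℕ) (p : Pt) : inDB tR tD sR sD (Mp p) = inDB sR sD tR tD p := by simp only [inDB, inBlk_Mp, isPocket_Mp]

/-- Bottom-removal columns are `M`-equivariant. [folklore] -/
theorem rem0_Mp (t s : ℕ) (p : Pt) : rem0 t s (Mp p) = rem0 s t p := by
  simp only [rem0, inRB_Mp, tnZ_Mp, nbrCount_U_Mp (inRB t s) (inRB s t) (inRB_Mp t s)]

/-- Top-removal columns are `M`-equivariant. [folklore] -/
theorem remM_Mp (t s : ℕ) (p : Pt) : remM t s (Mp p) = remM s t p := by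
  simp only [remM, inRB_Mp, tnZ_Mp, nbrCount_NU_Mp (inRB t s) (inRB s t) (inRB_Mp t s)]

/-- `remAny` is `M`-equivariant. [folklore] -/
theorem remAny_Mp (t s : ℕ) (p : Pt) : remAny t s (Mp p) = remAny s t p := by simp only [remAny, rem0_Mp, remM_Mp]

/-- A disjunction over the six directions is `M`-equivariant. [folklore] -/
theorem any_dirs_Mp (f g : Pt → Bool) (h : ∀ d, f d = g (Mp d)) : dirs.any f = dirs.any g := by
  simp only [dirs, List.any_cons, List.any_nil, h, Bool.or_false]
  simp only [Mp, Int.reduceNeg, Int.reduceAdd, neg_zero, add_zero]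
  cases g (1, 0) <;> cases g (-1, 1) <;> cases g (0, -1) <;> cases g (-1, 0) <;> cases g (1, -1) <;> cases g (0, 1) <;> rfl

/-- The certification of `E`-columns is `M`-equivariant. [folklore] -/
theorem certE_Mp (tR tD sR sD : ℕ) (a : Pt) : certE tR tD sR sD (Mp a) = certE sR sD tR tD a := by
  simp only [certE, inRB_Mp, remAny_Mp, Mp_beq_zero]
  congr 1
  refine congrArg _ (any_dirs_Mp _ _ fun d => ?_)
  simp only [Mp_shift, inDB_Mp, remAny_Mp]

/-- The certification of `w'`-columns is `M`-equivariant. [folklore] -/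
theorem certW_Mp (tR tD sR sD : ℕ) (a b c : Pt) : certW tR tD sR sD (Mp a) (Mp b) (Mp c) = certW sR sD tR tD a b c := by
  simp only [certW, inDB_Mp, remAny_Mp, Mp_beq_zero, Mp_beq]
  congr 1
  refine congrArg _ (any_dirs_Mp _ _ fun d => ?_)
  simp only [Mp_shift, inDB_Mp, remAny_Mp, Mp_beq, Mp_beq_zero]

/-- The type test is `M`-equivariant. [folklore] -/
theorem tyOK_Mp (tR sR : ℕ) (a1 a2 : Pt) (ty : ℕ) : tyOK tR sR (Mp a1) (Mp a2) ty = tyOK sR tR a1 a2 ty := by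
  simp only [tyOK, Mp_beq, rem0_Mp, remM_Mp]

/-- **Admissibility is `M`-equivariant** with the class parameters swapped. [folklore] -/
theorem admissible_Mp (tR tD sR sD : ℕ) (a1 a2 a3 : Pt) (ty : ℕ) :
    admissible tR tD sR sD (Mp a1) (Mp a2) (Mp a3) ty = admissible sR sD tR tD a1 a2 a3 ty := by
  rw [admissible_eq, admissible_eq, certE_Mp, certE_Mp, certW_Mp, tyOK_Mp]

/-- A point of hexagonal norm `≤ 3` has both coordinates in `[−3, 3]`. [folklore] -/
private theorem abs_le_of_tnZ_le' {p : Pt} (h : tnZ p ≤ 3) : -3 ≤ p.1 ∧ p.1 ≤ 3 ∧ -3 ≤ p.2 ∧ p.2 ≤ 3 := by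
  have h1 : |p.1| ≤ 3 := (le_max_left _ _).trans h
  have h2 : |p.2| ≤ 3 := ((le_max_left _ _).trans (le_max_right _ _)).trans h
  rw [abs_le] at h1 h2
  exact ⟨h1.1, h1.2, h2.1, h2.2⟩

/-- **`hexPts` is the hexagon `{tnZ ≤ 3}`.** [folklore] -/
theorem mem_hexPts_iff (p : Pt) : p ∈ hexPts ↔ tnZ p ≤ 3 := by
  constructor
  · intro h; revert p; decide
  · intro h
    obtain ⟨a1, a2, b1, b2⟩ := abs_le_of_tnZ_le' h
    obtain ⟨x, y⟩ := p
    simp only at a1 a2 b1 b2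
    interval_cases x <;> interval_cases y <;> revert h <;> decide

/-- `hexPts` is `M`-invariant. [folklore] -/
theorem Mp_mem_hexPts {p : Pt} (h : p ∈ hexPts) : Mp p ∈ hexPts := by rw [mem_hexPts_iff] at h ⊢; rwa [tnZ_Mp]

/-- A rerouting or cleared column lies in `hexPts`. [folklore] -/
theorem mem_hexPts_of_inBlk {t s : ℕ} {p : Pt} (h : inBlk t s p = true) : p ∈ hexPts := by
  rw [mem_hexPts_iff]; simp only [inBlk, Bool.and_eq_true, decide_eq_true_eq] at h; exact h.1.1

/-! ## §2 Equivariance of legs, entry tests, hub slots and claws -/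

/-- Adjacency is `M`-invariant. [folklore] -/
theorem adjH_Mp (a b : Pt) : adjH (Mp a) (Mp b) = adjH a b := by
  have key : ∀ a b : Pt, adjH a b = true → adjH (Mp a) (Mp b) = true := by
    intro a b h
    simp only [adjH, List.any_eq_true, beq_iff_eq] at h ⊢
    obtain ⟨d, hd, rfl⟩ := h
    refine ⟨Mp d, ?_, ?_⟩
    · simp only [dirs, List.mem_cons, List.not_mem_nil, or_false] at hd ⊢
      rcases hd with rfl | rfl | rfl | rfl | rfl | rfl <;> simp [Mp]
    · rw [Mp_shift, Mp_Mp]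
  rw [Bool.eq_iff_iff]
  exact ⟨fun h => by simpa using key _ _ h, key a b⟩

/-- `penult` commutes with `M`. [folklore] -/
theorem penult_map_Mp (l : List Pt) : penult (l.map Mp) = Mp (penult l) := by
  simp only [penult, ← List.map_reverse, ← List.map_drop]
  cases (l.reverse.drop 1) with
  | nil => rfl
  | cons a t => rfl

/-- **Legs are `M`-equivariant.** [folklore] -/
theorem LegProps.mapMp {R R' : Pt → Bool} (hR : ∀ q, R' (Mp q) = R q) {avoid : List Pt} {s a : Pt} {l : List Pt} (h : LegProps R avoid s a l) :
    LegProps R' (avoid.map Mp) (Mp s) (Mp a) (l.map Mp) where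
  ne_nil := by simpa using h.ne_nil
  head := by rw [List.head_map, h.head]
  last := by rw [List.getLast_map, h.last]
  two_le := by simpa using h.two_le
  chain := by rw [List.isChain_map]; exact h.chain.imp fun a b hab => by rw [adjH_Mp]; exact hab
  nodup := h.nodup.map Mp_injective
  mem_R := fun w hw => by obtain ⟨v, hv, rfl⟩ := List.mem_map.1 hw; rw [hR]; exact h.mem_R v hv
  not_avoid := fun w hw hwa => by
    obtain ⟨v, hv, rfl⟩ := List.mem_map.1 hw
    obtain ⟨v', hv', e⟩ := List.mem_map.1 hwa
    exact h.not_avoid v hv (Mp_injective e ▸ hv')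

/-- Membership of `P` among the columns `a ± U` is `M`-invariant (`M` permutes `U`). [folklore] -/
theorem anyU_Mp (a P : Pt) :
    (([(1, 0), (-1, 1), (0, -1)] : List Pt).any (fun u => Mp P == ((Mp a).1 + u.1, (Mp a).2 + u.2))) =
        ([(1, 0), (-1, 1), (0, -1)] : List Pt).any (fun u => P == (a.1 + u.1, a.2 + u.2)) ∧
      (([(1, 0), (-1, 1), (0, -1)] : List Pt).any (fun u => Mp P == ((Mp a).1 - u.1, (Mp a).2 - u.2))) =
        ([(1, 0), (-1, 1), (0, -1)] : List Pt).any (fun u => P == (a.1 - u.1, a.2 - u.2)) := by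
  simp only [List.any_cons, List.any_nil, Bool.or_false, Mp_shift, Mp_shift_sub, Mp_beq]
  simp only [Mp, Int.reduceNeg, Int.reduceAdd, neg_zero, add_zero, sub_zero]
  constructor <;> rw [Bool.eq_iff_iff] <;> simp only [Bool.or_eq_true, beq_iff_eq] <;> tauto

/-- The lower entry test is `M`-equivariant. [folklore] -/
theorem penLo_Mp (t s : ℕ) (a : Pt) (τ : ℕ) (P : Pt) : penLo t s (Mp a) τ (Mp P) = penLo s t a τ P := by
  obtain ⟨h1, h2⟩ := anyU_Mp a P
  simp only [penLo, h1, h2, rem0_Mp]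

/-- The upper entry test is `M`-equivariant. [folklore] -/
theorem penHi_Mp (t s : ℕ) (a : Pt) (τ : ℕ) (P : Pt) : penHi t s (Mp a) τ (Mp P) = penHi s t a τ P := by
  obtain ⟨h1, h2⟩ := anyU_Mp a P
  simp only [penHi, h1, h2, remM_Mp]

/-- The direction index of the mirrored slot: `M` fixes `u₀` and exchanges `u₁ ↔ u₂`. [folklore] -/
def piM (i : ℕ) : ℕ := if i = 1 then 2 else if i = 2 then 1 else i

/-- **Hub slots are `M`-equivariant**: the slot `(M Q, π i, up)` has `b`-column `M bc` and the chain-port / exit columns of `(Q, i, up)` mirrored (exchanged for `i = 0`).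
[folklore] -/
theorem hubCols_Mp {Q : Pt} {i : ℕ} (hi : i ≤ 2) (up : Bool) {bc F0 F1 X0 X1 : Pt} (hh : hubCols Q i up = (bc, F0, F1, X0, X1)) :
    hubCols (Mp Q) (piM i) up = (Mp bc, Mp F0, Mp F1, Mp X0, Mp X1) ∨ hubCols (Mp Q) (piM i) up = (Mp bc, Mp F1, Mp F0, Mp X1, Mp X0) := by
  obtain ⟨q1, q2⟩ := Q
  simp only [hubCols, Prod.mk.injEq] at hh
  obtain ⟨rfl, rfl, rfl, rfl, rfl⟩ := hh
  interval_cases i <;> cases up <;> simp [hubCols, piM, others, uvec, scale, Mp] <;> omega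

/-- `piM i ≤ 2`. [folklore] -/
theorem piM_le {i : ℕ} (hi : i ≤ 2) : piM i ≤ 2 := by unfold piM; split_ifs <;> omega

/-- **Claws are `M`-equivariant**: a claw of the class `(t_R, t_D, s_R, s_D)` for the mirrored configuration gives a claw of the class `(s_R, s_D, t_R, t_D)` for the
original configuration. [cite: DuminilCopinSidoraviciusTassion2016, §2.3 (proof of Fact 2)] -/
theorem ClawProps.ofMp {tR tD sR sD : ℕ} {a1 a2 a3 : Pt} {ty : ℕ} {Q : Pt} {i : ℕ} {up : Bool} {bc F0 F1 X0 X1 s1 s2 s3 : Pt} {l1 l2 l3 : List Pt}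
    (h : ClawProps tR tD sR sD (Mp a1) (Mp a2) (Mp a3) ty Q i up bc F0 F1 X0 X1 s1 s2 s3 l1 l2 l3) :
    ∃ F0' F1' X0' X1' : Pt, ClawProps sR sD tR tD a1 a2 a3 ty (Mp Q) (piM i) up (Mp bc) F0' F1' X0' X1' (Mp s1) (Mp s2) (Mp s3)
      (l1.map Mp) (l2.map Mp) (l3.map Mp) := by
  have hne : ∀ {p q : Pt}, p ≠ Mp q → Mp p ≠ q := fun hpq e => hpq (by rw [← e, Mp_Mp])
  have hav : ∀ (x y : Pt), (if (Mp a1 == Mp a2) = true then [Q, bc, x] else [Q, bc, y, x]).map Mp =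
      (if (a1 == a2) = true then [Mp Q, Mp bc, Mp x] else [Mp Q, Mp bc, Mp y, Mp x]) := fun x y => by
    rw [Mp_beq]; split_ifs <;> simp
  have hR : ∀ q, inRB sR tR (Mp q) = inRB tR sR q := fun q => inRB_Mp sR tR q
  have hD : ∀ q, inDB sR sD tR tD (Mp q) = inDB tR tD sR sD q := fun q => inDB_Mp sR sD tR tD q
  have l1' := h.leg1.mapMp hR; rw [hav] at l1'; simp only [Mp_Mp] at l1'
  have l2' := h.leg2.mapMp hR; rw [hav] at l2'; simp only [Mp_Mp] at l2'
  have l3' := h.leg3.mapMp hD; simp only [List.map_cons, List.map_nil, Mp_Mp] at l3'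
  have heq : Mp a1 = Mp a2 ↔ a1 = a2 := ⟨fun e => Mp_injective e, fun e => by rw [e]⟩
  rcases hubCols_Mp h.hi up h.hh with hh' | hh'
  · refine ⟨Mp F0, Mp F1, Mp X0, Mp X1, hh', piM_le h.hi, by rw [inRB_Mp]; exact h.hQ, by rw [tnZ_Mp]; exact h.hQ2,
      ⟨hne h.hQa.1, hne h.hQa.2.1, hne h.hQa.2.2⟩, fun hu => by rw [rem0_Mp]; exact h.hQ0 hu, fun hu => by rw [remM_Mp]; exact h.hQm hu,
      by rw [inRB_Mp]; exact h.hbc, ⟨hne h.hbca.1, hne h.hbca.2.1, hne h.hbca.2.2⟩, ?_, l1', l2', l3', ?_, ?_, ?_, ?_, ?_⟩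
    · obtain ⟨A, B, X, hAB, hX, harr⟩ := h.hst
      refine ⟨Mp A, Mp B, Mp X, ?_, ?_, ?_⟩
      · rcases hAB with ⟨rfl, rfl⟩ | ⟨rfl, rfl⟩ <;> simp
      · rcases hX with rfl | rfl <;> simp
      · rcases harr with e | e | e <;> simp only [Prod.mk.injEq] at e <;> obtain ⟨rfl, rfl, rfl⟩ := e <;> simp
    · intro e; have := h.pen1 (by rw [e]); rw [penult_map_Mp, ← penLo_Mp tR sR, Mp_Mp]; exact this
    · intro e; have := h.pen2 (by rw [e]); rw [penult_map_Mp, ← penHi_Mp tR sR, Mp_Mp]; exact this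
    · intro w hw hw2
      obtain ⟨v, hv, rfl⟩ := List.mem_map.1 hw; obtain ⟨v', hv', e⟩ := List.mem_map.1 hw2
      obtain ⟨h1, h2⟩ := h.d12 v hv (Mp_injective e ▸ hv')
      exact ⟨heq.1 h1, by rw [h2, Mp_Mp]⟩
    · intro w hw hw1; obtain ⟨v, hv, rfl⟩ := List.mem_map.1 hw; obtain ⟨v', hv', e⟩ := List.mem_map.1 hw1
      exact h.d31 v hv (Mp_injective e ▸ hv')
    · intro w hw hw2; obtain ⟨v, hv, rfl⟩ := List.mem_map.1 hw; obtain ⟨v', hv', e⟩ := List.mem_map.1 hw2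
      exact h.d32 v hv (Mp_injective e ▸ hv')
  · refine ⟨Mp F1, Mp F0, Mp X1, Mp X0, hh', piM_le h.hi, by rw [inRB_Mp]; exact h.hQ, by rw [tnZ_Mp]; exact h.hQ2,
      ⟨hne h.hQa.1, hne h.hQa.2.1, hne h.hQa.2.2⟩, fun hu => by rw [rem0_Mp]; exact h.hQ0 hu, fun hu => by rw [remM_Mp]; exact h.hQm hu,
      by rw [inRB_Mp]; exact h.hbc, ⟨hne h.hbca.1, hne h.hbca.2.1, hne h.hbca.2.2⟩, ?_, l1', l2', l3', ?_, ?_, ?_, ?_, ?_⟩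
    · obtain ⟨A, B, X, hAB, hX, harr⟩ := h.hst
      refine ⟨Mp A, Mp B, Mp X, ?_, ?_, ?_⟩
      · rcases hAB with ⟨rfl, rfl⟩ | ⟨rfl, rfl⟩ <;> simp
      · rcases hX with rfl | rfl <;> simp
      · rcases harr with e | e | e <;> simp only [Prod.mk.injEq] at e <;> obtain ⟨rfl, rfl, rfl⟩ := e <;> simp
    · intro e; have := h.pen1 (by rw [e]); rw [penult_map_Mp, ← penLo_Mp tR sR, Mp_Mp]; exact this
    · intro e; have := h.pen2 (by rw [e]); rw [penult_map_Mp, ← penHi_Mp tR sR, Mp_Mp]; exact this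
    · intro w hw hw2
      obtain ⟨v, hv, rfl⟩ := List.mem_map.1 hw; obtain ⟨v', hv', e⟩ := List.mem_map.1 hw2
      obtain ⟨h1, h2⟩ := h.d12 v hv (Mp_injective e ▸ hv')
      exact ⟨heq.1 h1, by rw [h2, Mp_Mp]⟩
    · intro w hw hw1; obtain ⟨v, hv, rfl⟩ := List.mem_map.1 hw; obtain ⟨v', hv', e⟩ := List.mem_map.1 hw1
      exact h.d31 v hv (Mp_injective e ▸ hv')
    · intro w hw hw2; obtain ⟨v, hv, rfl⟩ := List.mem_map.1 hw; obtain ⟨v', hv', e⟩ := List.mem_map.1 hw2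
      exact h.d32 v hv (Mp_injective e ▸ hv')

/-! ## §3 A claw for every block class -/

/-- **A CLAW EXISTS FOR EVERY ADMISSIBLE CONFIGURATION OF EVERY BLOCK CLASS**, given the kernel statements `ClawHOK` of the ten classes `t_R = t_D = 3` (the classes
with `t_R ≤ 2` — then `s_R = s_D = 3` — by the mirror `M`). [cite: DuminilCopinSidoraviciusTassion2016, §2.3 (proof of Fact 2)] -/
theorem exists_claw (hK : ∀ sR sD : ℕ, sR ≤ sD → sD ≤ 3 → ClawHOK sR sD) {tR tD sR sD : ℕ} (hRD : tR ≤ tD) (hD3 : tD ≤ 3) (hSD : sR ≤ sD) (hE3 : sD ≤ 3)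
    (hone : tR = 3 ∨ sR = 3) {a1 a2 a3 : Pt} {ty : ℕ} (hty : ty < 10) (hadm : admissible tR tD sR sD a1 a2 a3 ty = true) :
    ∃ (Q : Pt) (i : ℕ) (up : Bool) (bc F0 F1 X0 X1 s1 s2 s3 : Pt) (l1 l2 l3 : List Pt),
      ClawProps tR tD sR sD a1 a2 a3 ty Q i up bc F0 F1 X0 X1 s1 s2 s3 l1 l2 l3 := by
  have hty' : ty ∈ List.range 10 := List.mem_range.2 hty
  -- the three columns lie in `hexPts`
  have hmem : ∀ {tR tD sR sD : ℕ} {a1 a2 a3 : Pt} {ty : ℕ}, admissible tR tD sR sD a1 a2 a3 ty = true → a1 ∈ hexPts ∧ a2 ∈ hexPts ∧ a3 ∈ hexPts := by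
    intro tR tD sR sD a1 a2 a3 ty h
    rw [admissible_eq] at h
    simp only [Bool.and_eq_true] at h
    obtain ⟨⟨⟨h1, h2⟩, h3⟩, -⟩ := h
    have e1 : inRB tR sR a1 = true := by simp only [certE, Bool.and_eq_true] at h1; exact h1.1.1
    have e2 : inRB tR sR a2 = true := by simp only [certE, Bool.and_eq_true] at h2; exact h2.1.1
    have e3 : inDB tR tD sR sD a3 = true := by simp only [certW, Bool.and_eq_true] at h3; exact h3.1.1.1.1
    simp only [inRB, inDB, Bool.and_eq_true] at e1 e2 e3
    exact ⟨mem_hexPts_of_inBlk e1.1, mem_hexPts_of_inBlk e2.1, mem_hexPts_of_inBlk e3.1⟩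
  rcases hone with rfl | rfl
  · -- kernel family
    have htD : tD = 3 := le_antisymm hD3 hRD
    subst htD
    obtain ⟨h1, h2, h3⟩ := hmem hadm
    have hs := clawH_isSome_of_clawHOK (hK sR sD hSD hE3) h1 h2 h3 hty' hadm
    obtain ⟨⟨Q, i, up, j, k, xi, l1, l2, l3⟩, hc⟩ := Option.isSome_iff_exists.1 hs
    obtain ⟨bc, F0, F1, X0, X1, s1, s2, s3, hP⟩ := clawH_sound hc
    exact ⟨Q, i, up, bc, F0, F1, X0, X1, s1, s2, s3, l1, l2, l3, hP⟩
  · -- mirrored family: `s_R = 3`, hence `s_D = 3`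
    have hsD : sD = 3 := le_antisymm hE3 hSD
    subst hsD
    have hadm' : admissible 3 3 tR tD (Mp a1) (Mp a2) (Mp a3) ty = true := by rw [admissible_Mp]; exact hadm
    obtain ⟨h1, h2, h3⟩ := hmem hadm'
    have hs := clawH_isSome_of_clawHOK (hK tR tD hRD hD3) h1 h2 h3 hty' hadm'
    obtain ⟨⟨Q, i, up, j, k, xi, l1, l2, l3⟩, hc⟩ := Option.isSome_iff_exists.1 hs
    obtain ⟨bc, F0, F1, X0, X1, s1, s2, s3, hP⟩ := clawH_sound hc
    obtain ⟨F0', F1', X0', X1', hP'⟩ := ClawProps.ofMp hP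
    exact ⟨_, _, _, _, _, _, _, _, _, _, _, _, _, _, hP'⟩

end Bcc111Claw

end Summit.CriticalPhenomena.PercolationContinuityZ3.Theorems.Transplant
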